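import Literature.NumberTheory.Sieve.QuadraticPhaseRecurrence
import Literature.NumberTheory.Sieve.MoebiusVaughanInverse
import HarnessLib

/-!
# Minor arcs for `∑ μ(n) e(αn² + βn)`: correlation with a quadratic phase implies major arc

Topic `Literature/NumberTheory/Sieve`. Everything in this file is PROVED (theorems only; no
definitions, no named facts).

B. Green, T. Tao, *Quadratic uniformity of the Möbius function*, Ann. Inst. Fourier 58 (2008)
[GreenTao2008QuadraticMobius], §7, Propositions 7.1–7.2 (= arXiv Props. 16–17, "correlation with
a quadratic phase implies major arc, I–II"): if `|∑_{n ≤ N} μ(n) e(αn² + βn)| ≥ δN` then there is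
`q ≪ ((1 + log N)/δ)^{O(1)}` with `‖qα‖_{ℝ/ℤ} ≪ ((1 + log N)/δ)^{O(1)} N^{-2}`.
The proof is the source's: Vaughan's identity and the inverse theorem for type I/II sums
(`QuadraticMoebius.typeI_inverse`, `typeII_inverse`), the quadratic Weyl inequality in inverse
form (`QuadraticMoebius.exists_distInt_mul_le_of_norm_quadratic_sum_ge`), pigeonholing of the
denominators, and "recurrent square phases are major arc"
(`QuadraticMoebius.exists_distInt_mul_le_of_sq_recurrent`) to clear the factor `d²`
(resp. `w² − w'²`). All constants are explicit but, as in the source, no attempt is made to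
optimise the exponents.

Main results (namespace `Literature.NumberTheory.Sieve.QuadraticMoebius`):
* `typeI_case_denominator`, `typeII_case_denominator` — the two cases of Prop. 7.1/7.2;
* `exists_denominator_of_large_quadratic_moebius_sum` — the minor-arc inverse theorem above.

## References
* B. Green, T. Tao, Ann. Inst. Fourier 58 (2008) 1863–1935, §7. [GreenTao2008QuadraticMobius]
-/

noncomputable section

open Finset Real ArithmeticFunction
open scoped FourierTransform ArithmeticFunction.Moebius ComplexConjugate

namespace Literature.NumberTheory.Sieve.QuadraticMoebius

open Literature.NumberTheory.Sieve (moebiusTrunc)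
open Literature.NumberTheory.Sieve.Vinogradov (distInt distInt_nonneg)
open Literature.NumberTheory.Sieve.Teravainen2024 (exists_popular_label)

/-! ### Small tools -/

/-- `N/(2d) ≤ ⌊N/d⌋` for `1 ≤ d ≤ N`. [folklore] -/
private theorem div_two_mul_le_natDiv {N d : ℕ} (hd : 1 ≤ d) (hdN : d ≤ N) :
    (N : ℝ) / (2 * d) ≤ ((N / d : ℕ) : ℝ) := by
  have hd0 : (0 : ℝ) < d := by exact_mod_cast hd
  have h1 : 1 ≤ N / d := (Nat.le_div_iff_mul_le hd).mpr (by rw [one_mul]; exact hdN)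
  have h1r : (1 : ℝ) ≤ ((N / d : ℕ) : ℝ) := by exact_mod_cast h1
  have h2 : (N : ℝ) < d * (((N / d : ℕ) : ℝ) + 1) := by
    have h := Nat.lt_div_mul_add (a := N) hd
    have : (N : ℝ) < ((N / d * d + d : ℕ) : ℝ) := by exact_mod_cast h
    push_cast at this
    linarith
  rw [div_le_iff₀ (by positivity)]
  nlinarith

/-- The type I Weyl sum in the shape of the Weyl inequality. [folklore] -/
private theorem sum_Icc_fourierChar_dilate_eq (α β : ℝ) (d L : ℕ) :
    ∑ w ∈ Icc 1 L, (𝐞 (α * (((d * w : ℕ) : ℝ)) ^ 2 + β * ((d * w : ℕ) : ℝ)) : ℂ) =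
      ∑ n ∈ Ioc 0 (0 + L), (𝐞 ((α * (d : ℝ) ^ 2) * (n : ℝ) ^ 2 + (β * d) * n) : ℂ) := by
  have hI : Icc 1 L = Ioc 0 (0 + L) := by ext w; simp only [mem_Icc, mem_Ioc]; omega
  rw [hI]
  refine Finset.sum_congr rfl fun w _ => ?_
  congr 2
  push_cast
  ring

/-! ### The type I case -/

/-- **Correlation with a quadratic phase, type I case** (Green–Tao, AIF 2008, §7, proof of
Propositions 7.1–7.2, type I branch, with explicit constants). Suppose that for some `j` at least
`η² 2^j` integers `d ∈ [2^j, 2^{j+1}) ∩ [1, U]` have `‖∑_{w ≤ N/d} e(α(dw)² + β dw)‖ ≥ ηN/2^j`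
(the output of `typeI_inverse`). With `K₁ = C(8/η²)^A` the Weyl constant and `c = η²/(2K₁)`,
if `K₁ ≤ s`, `2K₁ ≤ η² s` and `2¹⁵ K₁ U² ≤ c² N²`, then some `1 ≤ q ≤ 2⁵² s¹⁷` has
`‖qα‖_{ℝ/ℤ} ≤ 2⁵² s¹⁷ / N²` (Weyl for each good `d`, pigeonhole the `k_d`, then either clear `d²`
by `exists_distInt_mul_le_of_sq_recurrent` or, for small `2^j`, take `q = k d²`).
[cite: GreenTao2008QuadraticMobius, §7, Propositions 7.1–7.2 (type I case)] -/
theorem typeI_case_denominator {A : ℕ} {C : ℝ} (hC1 : 1 ≤ C)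
    (hW : ∀ (η : ℝ) (a L : ℕ) (θ₂ θ₁ : ℝ), 0 < η → η ≤ 1 → 1 ≤ L →
        η * L ≤ ‖∑ n ∈ Ioc a (a + L), (𝐞 (θ₂ * (n : ℝ) ^ 2 + θ₁ * n) : ℂ)‖ →
        ∃ k : ℕ, 1 ≤ k ∧ (k : ℝ) ≤ C * (8 / η ^ 2) ^ A ∧
          distInt (k * θ₂) ≤ C * (8 / η ^ 2) ^ A / (L : ℝ) ^ 2)
    {N U : ℕ} (hU : 1 ≤ U) (hUN : U ≤ N) (α β : ℝ) (F : ℕ → ℂ)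
    (hF : ∀ n, F n = (𝐞 (α * (n : ℝ) ^ 2 + β * n) : ℂ))
    {η s : ℝ} (hη : 0 < η) (hη1 : η ≤ 1)
    (hKs : C * (8 / η ^ 2) ^ A ≤ s) (hcs : 2 * (C * (8 / η ^ 2) ^ A) ≤ η ^ 2 * s)
    (hlarge : 2 ^ 15 * (C * (8 / η ^ 2) ^ A) * (U : ℝ) ^ 2 ≤
      (η ^ 2 / (2 * (C * (8 / η ^ 2) ^ A))) ^ 2 * (N : ℝ) ^ 2)
    {j : ℕ} (hgood : η ^ 2 * 2 ^ j ≤ #((Icc 1 U).filter fun d => Nat.log 2 d = j ∧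
        η * N / 2 ^ j ≤ ‖∑ w ∈ Icc 1 (N / d), F (d * w)‖)) :
    ∃ q : ℕ, 1 ≤ q ∧ (q : ℝ) ≤ 2 ^ 52 * s ^ 17 ∧
      distInt (q * α) ≤ 2 ^ 52 * s ^ 17 / (N : ℝ) ^ 2 := by
  classical
  set K₁ : ℝ := C * (8 / η ^ 2) ^ A with hK₁
  have hη2 : 0 < η ^ 2 := by positivity
  have hη21 : η ^ 2 ≤ 1 := pow_le_one₀ hη.le hη1
  have h8 : (1 : ℝ) ≤ 8 / η ^ 2 := by
    rw [le_div_iff₀ hη2]; linarith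
  have hK₁1 : 1 ≤ K₁ := by
    rw [hK₁]; exact one_le_mul_of_one_le_of_one_le hC1 (one_le_pow₀ h8)
  have hK₁0 : 0 < K₁ := by linarith
  have hs1 : 1 ≤ s := hK₁1.trans hKs
  have hs0 : 0 < s := by linarith
  set c : ℝ := η ^ 2 / (2 * K₁) with hcdef
  have hc0 : 0 < c := by positivity
  have hc1 : c ≤ 1 := by
    rw [hcdef, div_le_one (by positivity)]; linarith
  have hcs' : 1 / c ≤ s := by
    rw [hcdef, one_div_div, div_le_iff₀ hη2]; linarith
  have hN0 : (0 : ℝ) < N := by exact_mod_cast (lt_of_lt_of_le Nat.one_pos (hU.trans hUN))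
  set D : ℕ := 2 ^ j with hDdef
  have hD0 : (0 : ℝ) < D := by rw [hDdef]; positivity
  set B := (Icc 1 U).filter (fun d => Nat.log 2 d = j ∧
    η * N / 2 ^ j ≤ ‖∑ w ∈ Icc 1 (N / d), F (d * w)‖) with hBdef
  have hBcard : η ^ 2 * D ≤ #B := by rw [hDdef]; push_cast; exact hgood
  have hmemB : ∀ d ∈ B, 1 ≤ d ∧ d ≤ U ∧ D ≤ d ∧ d < 2 * D ∧
      η * N / D ≤ ‖∑ w ∈ Icc 1 (N / d), F (d * w)‖ := by
    intro d hd
    rw [hBdef, Finset.mem_filter, mem_Icc] at hd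
    obtain ⟨⟨hd1, hdU⟩, hdj, hS⟩ := hd
    refine ⟨hd1, hdU, ?_, ?_, ?_⟩
    · rw [hDdef, ← hdj]; exact Nat.pow_log_le_self 2 (by omega)
    · rw [hDdef, ← hdj, mul_comm, ← pow_succ]; exact Nat.lt_pow_succ_log_self (by norm_num) d
    · rw [hDdef]; push_cast; exact hS
  -- Step 1: Weyl for each good `d`
  have hWeyl : ∀ d ∈ B, ∃ k : ℕ, 1 ≤ k ∧ (k : ℝ) ≤ K₁ ∧
      distInt (k * (α * (d : ℝ) ^ 2)) ≤ 16 * K₁ * (D : ℝ) ^ 2 / (N : ℝ) ^ 2 := by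
    intro d hd
    obtain ⟨hd1, hdU, hDd, hd2D, hS⟩ := hmemB d hd
    have hdN : d ≤ N := hdU.trans hUN
    set L : ℕ := N / d with hL
    have hL1 : 1 ≤ L := (Nat.le_div_iff_mul_le hd1).mpr (by rw [one_mul]; exact hdN)
    have hLr : (0 : ℝ) < L := by exact_mod_cast hL1
    have hdr : (0 : ℝ) < d := by exact_mod_cast hd1
    have hDd' : (D : ℝ) ≤ d := by exact_mod_cast hDd
    -- `ηL ≤ ‖∑‖`
    have hLle : (L : ℝ) ≤ N / D := by
      calc (L : ℝ) ≤ (N : ℝ) / d := Nat.cast_div_le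
        _ ≤ N / D := div_le_div_of_nonneg_left hN0.le hD0 hDd'
    have hsum : ∑ w ∈ Icc 1 (N / d), F (d * w) =
        ∑ n ∈ Ioc 0 (0 + L), (𝐞 ((α * (d : ℝ) ^ 2) * (n : ℝ) ^ 2 + (β * d) * n) : ℂ) := by
      rw [← sum_Icc_fourierChar_dilate_eq α β d L]
      exact Finset.sum_congr rfl fun w _ => hF _
    have hS' : η * L ≤ ‖∑ n ∈ Ioc 0 (0 + L),
        (𝐞 ((α * (d : ℝ) ^ 2) * (n : ℝ) ^ 2 + (β * d) * n) : ℂ)‖ := by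
      rw [← hsum]
      calc η * L ≤ η * (N / D) := mul_le_mul_of_nonneg_left hLle hη.le
        _ = η * N / D := by ring
        _ ≤ _ := hS
    obtain ⟨k, hk1, hkK, hdist⟩ := hW η 0 L (α * (d : ℝ) ^ 2) (β * d) hη hη1 hL1 hS'
    refine ⟨k, hk1, hkK, hdist.trans ?_⟩
    -- `K₁ / L² ≤ 16 K₁ D² / N²` from `L ≥ N/(2d) ≥ N/(4D)`
    have hL2 : (N : ℝ) / (4 * D) ≤ L := by
      have h1 := div_two_mul_le_natDiv hd1 hdN
      have hd2D' : (d : ℝ) ≤ 2 * D := by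
        have : ((d : ℕ) : ℝ) < ((2 * D : ℕ) : ℝ) := by exact_mod_cast hd2D
        push_cast at this; linarith
      calc (N : ℝ) / (4 * D) ≤ N / (2 * d) := by
            refine div_le_div_of_nonneg_left hN0.le (by positivity) (by linarith)
        _ ≤ L := h1
    have hL2' : (N : ℝ) ^ 2 / (16 * (D : ℝ) ^ 2) ≤ (L : ℝ) ^ 2 := by
      have h0 : 0 ≤ (N : ℝ) / (4 * D) := by positivity
      have := pow_le_pow_left₀ h0 hL2 2
      calc (N : ℝ) ^ 2 / (16 * (D : ℝ) ^ 2) = ((N : ℝ) / (4 * D)) ^ 2 := by ring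
        _ ≤ (L : ℝ) ^ 2 := this
    rw [hK₁.symm] at *
    calc K₁ / (L : ℝ) ^ 2 ≤ K₁ / ((N : ℝ) ^ 2 / (16 * (D : ℝ) ^ 2)) :=
          div_le_div_of_nonneg_left hK₁0.le (by positivity) hL2'
      _ = 16 * K₁ * (D : ℝ) ^ 2 / (N : ℝ) ^ 2 := by field_simp
  choose! kf hkf1 hkfK hkfd using hWeyl
  -- Step 2: pigeonhole the `k_d`
  set Kn : ℕ := ⌊K₁⌋₊ with hKn
  have hKn1 : 1 ≤ Kn := by rw [hKn]; exact Nat.le_floor (by simpa using hK₁1)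
  have hKnle : (Kn : ℝ) ≤ K₁ := Nat.floor_le hK₁0.le
  obtain ⟨k₀, hk₀1, hk₀K, hpop⟩ := exists_popular_label B kf hKn1 fun d hd =>
    ⟨hkf1 d hd, Nat.le_floor (hkfK d hd)⟩
  set G := B.filter (fun d => kf d = k₀) with hGdef
  have hGcard : c * ((2 * D : ℕ) : ℝ) ≤ #G := by
    refine le_trans ?_ hpop
    have hKn0 : (0 : ℝ) < Kn := by exact_mod_cast hKn1
    rw [le_div_iff₀ hKn0]
    push_cast
    calc c * (2 * (D : ℝ)) * Kn ≤ c * (2 * D) * K₁ := mul_le_mul_of_nonneg_left hKnle (by positivity)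
      _ = η ^ 2 * D := by rw [hcdef]; field_simp
      _ ≤ #B := hBcard
  have hGsub : G ⊆ Icc 1 (2 * D) := by
    intro d hd
    have hd' := hmemB d (Finset.mem_filter.mp hd).1
    rw [Finset.mem_Icc]; exact ⟨hd'.1, hd'.2.2.2.1.le⟩
  have hGgood : ∀ d ∈ G, distInt ((k₀ : ℝ) * α * (d : ℝ) ^ 2 - 0) ≤
      16 * K₁ * (D : ℝ) ^ 2 / (N : ℝ) ^ 2 := by
    intro d hd
    obtain ⟨hdB, hdk⟩ := Finset.mem_filter.mp hd
    have h := hkfd d hdB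
    rw [hdk] at h
    rw [sub_zero, mul_assoc]; exact h
  -- `B` is nonempty, so `D ≤ U`
  have hGne : G.Nonempty := by
    rw [← Finset.card_pos]
    have : (0 : ℝ) < #G := lt_of_lt_of_le (by positivity) hGcard
    exact_mod_cast this
  obtain ⟨d₀, hd₀⟩ := hGne
  have hd₀B := hmemB d₀ (Finset.mem_filter.mp hd₀).1
  have hDU : (D : ℝ) ≤ U := by exact_mod_cast hd₀B.2.2.1.trans hd₀B.2.1
  set ε : ℝ := 16 * K₁ * (D : ℝ) ^ 2 / (N : ℝ) ^ 2 with hεdef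
  have hε0 : 0 < ε := by positivity
  -- `2^11 ε ≤ c²`
  have hεc : 2 ^ 11 * ε ≤ c ^ 2 := by
    rw [hεdef]
    have hN2 : (0 : ℝ) < (N : ℝ) ^ 2 := by positivity
    rw [show (2 : ℝ) ^ 11 * (16 * K₁ * (D : ℝ) ^ 2 / (N : ℝ) ^ 2) =
      2 ^ 15 * K₁ * (D : ℝ) ^ 2 / (N : ℝ) ^ 2 by ring, div_le_iff₀ hN2]
    have hD2 : (D : ℝ) ^ 2 ≤ (U : ℝ) ^ 2 := pow_le_pow_left₀ hD0.le hDU 2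
    calc 2 ^ 15 * K₁ * (D : ℝ) ^ 2 ≤ 2 ^ 15 * K₁ * (U : ℝ) ^ 2 :=
          mul_le_mul_of_nonneg_left hD2 (by positivity)
      _ ≤ c ^ 2 * (N : ℝ) ^ 2 := by rw [hcdef]; exact hlarge
  by_cases hDlarge : (2 : ℝ) ^ 25 ≤ c ^ 8 * ((2 * D : ℕ) : ℝ)
  · -- Step 3a: clear `d²`
    obtain ⟨q', hq'1, hq'le, hq'dist⟩ := exists_distInt_mul_le_of_sq_recurrent (κ := k₀ * α)
      (θ := 0) hc0 hc1 hε0 G hGsub hGcard hGgood hDlarge hεc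
    refine ⟨q' * k₀, Nat.one_le_iff_ne_zero.mpr (Nat.mul_ne_zero (by omega) (by omega)), ?_, ?_⟩
    · have hk₀r : (k₀ : ℝ) ≤ K₁ := le_trans (by exact_mod_cast hk₀K) hKnle
      push_cast
      calc (q' : ℝ) * k₀ ≤ 2 ^ 17 / c ^ 6 * K₁ :=
            mul_le_mul hq'le hk₀r (Nat.cast_nonneg _) (by positivity)
        _ = 2 ^ 17 * (1 / c) ^ 6 * K₁ := by rw [one_div_pow]; ring
        _ ≤ 2 ^ 17 * s ^ 6 * s := by
            refine mul_le_mul (mul_le_mul_of_nonneg_left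
              (pow_le_pow_left₀ (by positivity) hcs' 6) (by norm_num)) hKs hK₁0.le (by positivity)
        _ = 2 ^ 17 * s ^ 7 := by ring
        _ ≤ 2 ^ 52 * s ^ 17 :=
            mul_le_mul (by norm_num) (pow_le_pow_right₀ hs1 (by norm_num)) (by positivity)
              (by positivity)
    · have e : ((q' * k₀ : ℕ) : ℝ) * α = (q' : ℝ) * (k₀ * α) := by push_cast; ring
      rw [e]
      refine hq'dist.trans ?_
      have hDr : ((2 * D : ℕ) : ℝ) = 2 * D := by push_cast; ring
      rw [hDr, hεdef]
      have hN2 : (0 : ℝ) < (N : ℝ) ^ 2 := by positivity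
      rw [show 2 ^ 42 / c ^ 12 * (16 * K₁ * (D : ℝ) ^ 2 / (N : ℝ) ^ 2) / (2 * (D : ℝ)) ^ 2 =
        2 ^ 44 * (1 / c) ^ 12 * K₁ / (N : ℝ) ^ 2 by field_simp; ring]
      refine div_le_div_of_nonneg_right ?_ hN2.le
      calc 2 ^ 44 * (1 / c) ^ 12 * K₁ ≤ 2 ^ 44 * s ^ 12 * s := by
            refine mul_le_mul (mul_le_mul_of_nonneg_left
              (pow_le_pow_left₀ (by positivity) hcs' 12) (by norm_num)) hKs hK₁0.le (by positivity)
        _ = 2 ^ 44 * s ^ 13 := by ring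
        _ ≤ 2 ^ 52 * s ^ 17 :=
            mul_le_mul (by norm_num) (pow_le_pow_right₀ hs1 (by norm_num)) (by positivity)
              (by positivity)
  · -- Step 3b: small `D`: take `q = k₀ d₀²`
    push Not at hDlarge
    have hDsmall : 2 * (D : ℝ) < 2 ^ 25 * (1 / c) ^ 8 := by
      have hc8 : 0 < c ^ 8 := by positivity
      have : ((2 * D : ℕ) : ℝ) < 2 ^ 25 / c ^ 8 := by
        rw [lt_div_iff₀ hc8]; linarith
      rw [one_div_pow, ← div_eq_mul_one_div]
      push_cast at this; exact this
    refine ⟨k₀ * d₀ ^ 2, Nat.one_le_iff_ne_zero.mpr (Nat.mul_ne_zero (by omega)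
      (pow_ne_zero 2 (by have := hd₀B.1; omega))), ?_, ?_⟩
    · have hk₀r : (k₀ : ℝ) ≤ K₁ := le_trans (by exact_mod_cast hk₀K) hKnle
      have hd₀r : (d₀ : ℝ) < 2 * D := by
        have : ((d₀ : ℕ) : ℝ) < ((2 * D : ℕ) : ℝ) := by exact_mod_cast hd₀B.2.2.2.1
        push_cast at this; exact this
      have hd₀2 : (d₀ : ℝ) ^ 2 ≤ (2 ^ 25 * (1 / c) ^ 8) ^ 2 :=
        pow_le_pow_left₀ (Nat.cast_nonneg _) (hd₀r.le.trans hDsmall.le) 2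
      push_cast
      calc (k₀ : ℝ) * (d₀ : ℝ) ^ 2 ≤ K₁ * (2 ^ 25 * (1 / c) ^ 8) ^ 2 :=
            mul_le_mul hk₀r hd₀2 (by positivity) hK₁0.le
        _ = 2 ^ 50 * (1 / c) ^ 16 * K₁ := by ring
        _ ≤ 2 ^ 50 * s ^ 16 * s := by
            refine mul_le_mul (mul_le_mul_of_nonneg_left
              (pow_le_pow_left₀ (by positivity) hcs' 16) (by norm_num)) hKs hK₁0.le (by positivity)
        _ = 2 ^ 50 * s ^ 17 := by ring
        _ ≤ 2 ^ 52 * s ^ 17 := mul_le_mul_of_nonneg_right (by norm_num) (by positivity)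
    · have h := hGgood d₀ hd₀
      rw [sub_zero] at h
      have e : ((k₀ * d₀ ^ 2 : ℕ) : ℝ) * α = (k₀ : ℝ) * α * (d₀ : ℝ) ^ 2 := by push_cast; ring
      rw [e]
      refine h.trans ?_
      have hN2 : (0 : ℝ) < (N : ℝ) ^ 2 := by positivity
      refine div_le_div_of_nonneg_right ?_ hN2.le
      have hD2 : (D : ℝ) ^ 2 ≤ (2 ^ 24 * (1 / c) ^ 8) ^ 2 := by
        refine pow_le_pow_left₀ hD0.le ?_ 2; linarith
      calc 16 * K₁ * (D : ℝ) ^ 2 ≤ 16 * K₁ * (2 ^ 24 * (1 / c) ^ 8) ^ 2 :=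
            mul_le_mul_of_nonneg_left hD2 (by positivity)
        _ = 2 ^ 52 * (1 / c) ^ 16 * K₁ := by ring
        _ ≤ 2 ^ 52 * s ^ 16 * s := by
            refine mul_le_mul (mul_le_mul_of_nonneg_left
              (pow_le_pow_left₀ (by positivity) hcs' 16) (by norm_num)) hKs hK₁0.le (by positivity)
        _ = 2 ^ 52 * s ^ 17 := by ring

/-! ### The type II case -/

/-- `conj e(x) = e(−x)`. [folklore] -/
private theorem conj_fourierChar (x : ℝ) : conj (𝐞 x : ℂ) = 𝐞 (-x) := by
  rw [AddChar.map_neg_eq_inv, Circle.coe_inv_eq_conj]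

/-- The type II correlation sum in the shape of the Weyl inequality. [folklore] -/
private theorem sum_Ioc_fourierChar_corr_eq (α β : ℝ) (w w' K L : ℕ) (F : ℕ → ℂ)
    (hF : ∀ n, F n = (𝐞 (α * (n : ℝ) ^ 2 + β * n) : ℂ)) :
    ∑ d ∈ Ioc K (K + L), F (d * w) * conj (F (d * w')) =
      ∑ n ∈ Ioc K (K + L), (𝐞 ((α * ((w : ℝ) ^ 2 - (w' : ℝ) ^ 2)) * (n : ℝ) ^ 2 +
        (β * ((w : ℝ) - w')) * n) : ℂ) := by
  refine Finset.sum_congr rfl fun d _ => ?_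
  rw [hF, hF, conj_fourierChar, ← Circle.coe_mul, ← AddChar.map_add_eq_mul]
  congr 2
  push_cast
  ring

/-- **Correlation with a quadratic phase, type II case** (Green–Tao, AIF 2008, §7, proof of
Propositions 7.1–7.2, type II branch, with explicit constants). Suppose that, for a dyadic scale
`K` (`u ≤ K`, `Ku ≤ N`, `u ≥ 2`) and some `w'`, at least `η(N/K) − 1` integers `w ≤ N/K`,
`w ≠ w'`, have `‖∑_{K<d≤min(2K,N/w,N/w')} e(φ(dw) − φ(dw'))‖ ≥ ηK`, `φ(n) = αn² + βn` (the output
of `typeII_inverse`). With `K₂ = C(8/η²)^A` the Weyl constant and `c = η/(2K₂)`, if `K₂ ≤ s`,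
`2K₂ ≤ ηs`, `η(N/K) ≥ 2`, `c⁸(N/K) ≥ 2²⁵` and `2¹¹K₂ ≤ c²η²K²`, then some
`1 ≤ q ≤ 2⁵² s¹⁷` has `‖qα‖_{ℝ/ℤ} ≤ 2⁵² s¹⁷/N²` (Weyl for each good `w` — leading coefficient
`α(w² − w'²)` —, pigeonhole the `k_w`, and clear `w² − w'²` by
`exists_distInt_mul_le_of_sq_recurrent`).
[cite: GreenTao2008QuadraticMobius, §7, Propositions 7.1–7.2 (type II case)] -/
theorem typeII_case_denominator {A : ℕ} {C : ℝ} (hC1 : 1 ≤ C)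
    (hW : ∀ (η : ℝ) (a L : ℕ) (θ₂ θ₁ : ℝ), 0 < η → η ≤ 1 → 1 ≤ L →
        η * L ≤ ‖∑ n ∈ Ioc a (a + L), (𝐞 (θ₂ * (n : ℝ) ^ 2 + θ₁ * n) : ℂ)‖ →
        ∃ k : ℕ, 1 ≤ k ∧ (k : ℝ) ≤ C * (8 / η ^ 2) ^ A ∧
          distInt (k * θ₂) ≤ C * (8 / η ^ 2) ^ A / (L : ℝ) ^ 2)
    {N u K : ℕ} (hu : 2 ≤ u) (huK : u ≤ K) (hKu : K * u ≤ N) (α β : ℝ) (F : ℕ → ℂ)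
    (hF : ∀ n, F n = (𝐞 (α * (n : ℝ) ^ 2 + β * n) : ℂ))
    {η s : ℝ} (hη : 0 < η) (hη1 : η ≤ 1)
    (hKs : C * (8 / η ^ 2) ^ A ≤ s) (hcs : 2 * (C * (8 / η ^ 2) ^ A) ≤ η * s)
    (hl1 : 2 ≤ η * ((N / K : ℕ) : ℝ))
    (hl2 : (2 : ℝ) ^ 25 ≤ (η / (2 * (C * (8 / η ^ 2) ^ A))) ^ 8 * ((N / K : ℕ) : ℝ))
    (hl3 : 2 ^ 11 * (C * (8 / η ^ 2) ^ A) ≤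
      (η / (2 * (C * (8 / η ^ 2) ^ A))) ^ 2 * η ^ 2 * (K : ℝ) ^ 2)
    {w' : ℕ}
    (hgood : η * ((N / K : ℕ) : ℝ) - 1 ≤ #((Icc 1 (N / K)).filter fun w => w ≠ w' ∧
        η * K ≤ ‖∑ d ∈ Ioc K (min (2 * K) (min (N / w) (N / w'))),
          F (d * w) * conj (F (d * w'))‖)) :
    ∃ q : ℕ, 1 ≤ q ∧ (q : ℝ) ≤ 2 ^ 52 * s ^ 17 ∧
      distInt (q * α) ≤ 2 ^ 52 * s ^ 17 / (N : ℝ) ^ 2 := by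
  classical
  set K₂ : ℝ := C * (8 / η ^ 2) ^ A with hK₂
  have hη2 : 0 < η ^ 2 := by positivity
  have hη21 : η ^ 2 ≤ 1 := pow_le_one₀ hη.le hη1
  have h8 : (1 : ℝ) ≤ 8 / η ^ 2 := by
    rw [le_div_iff₀ hη2]; linarith
  have hK₂1 : 1 ≤ K₂ := by
    rw [hK₂]; exact one_le_mul_of_one_le_of_one_le hC1 (one_le_pow₀ h8)
  have hK₂0 : 0 < K₂ := by linarith
  have hs1 : 1 ≤ s := hK₂1.trans hKs
  have hs0 : 0 < s := by linarith
  set c : ℝ := η / (2 * K₂) with hcdef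
  have hc0 : 0 < c := by positivity
  have hc1 : c ≤ 1 := by
    rw [hcdef, div_le_one (by positivity)]; linarith
  have hcs' : 1 / c ≤ s := by
    rw [hcdef, one_div_div, div_le_iff₀ hη]; linarith
  have hηs' : 1 / η ≤ s := by rw [div_le_iff₀ hη]; linarith
  have hK1 : 1 ≤ K := le_trans (by omega) huK
  have hKr : (0 : ℝ) < K := by exact_mod_cast hK1
  have hKN2 : 2 * K ≤ N := le_trans (Nat.mul_le_mul_left K hu |>.trans_eq' (by ring)) hKu
  have hN0 : (0 : ℝ) < N := by
    have : 1 ≤ N := le_trans (by omega) hKN2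
    exact_mod_cast this
  set M : ℕ := N / K with hMdef
  have hMr : (0 : ℝ) < M := by
    by_contra h
    push Not at h
    nlinarith
  -- `K M ≥ N/2`
  have hKM : (N : ℝ) / 2 ≤ (K : ℝ) * M := by
    have h := Nat.lt_div_mul_add (a := N) hK1
    have h1 : (N : ℝ) < ((N / K * K + K : ℕ) : ℝ) := by exact_mod_cast h
    push_cast at h1
    have h2 : (2 * K : ℝ) ≤ N := by exact_mod_cast hKN2
    rw [hMdef]
    nlinarith
  set B := (Icc 1 M).filter (fun w => w ≠ w' ∧
    η * K ≤ ‖∑ d ∈ Ioc K (min (2 * K) (min (N / w) (N / w'))),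
      F (d * w) * conj (F (d * w'))‖) with hBdef
  have hBcard : η * M / 2 ≤ #B := by
    have : η * (M : ℝ) - 1 ≤ #B := hgood
    linarith
  -- Step 1: Weyl for each good `w`
  have hWeyl : ∀ w ∈ B, ∃ k : ℕ, 1 ≤ k ∧ (k : ℝ) ≤ K₂ ∧
      distInt (k * (α * ((w : ℝ) ^ 2 - (w' : ℝ) ^ 2))) ≤ K₂ / (η ^ 2 * (K : ℝ) ^ 2) := by
    intro w hw
    rw [hBdef, Finset.mem_filter] at hw
    obtain ⟨hwM, hww', hS⟩ := hw
    set K' : ℕ := min (2 * K) (min (N / w) (N / w')) with hK'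
    -- the sum is non-empty, so `K < K'`
    have hKK' : K < K' := by
      by_contra hle
      push Not at hle
      have hempty : Ioc K K' = ∅ := Finset.Ioc_eq_empty (by omega)
      rw [hempty, Finset.sum_empty, norm_zero] at hS
      have : (0 : ℝ) < η * K := by positivity
      linarith
    set L : ℕ := K' - K with hLdef
    have hL1 : 1 ≤ L := by omega
    have hKL : K' = K + L := by omega
    have hLK : L ≤ K := by omega
    have hLr : (0 : ℝ) < L := by exact_mod_cast hL1
    have hLKr : (L : ℝ) ≤ K := by exact_mod_cast hLK
    rw [hKL, sum_Ioc_fourierChar_corr_eq α β w w' K L F hF] at hS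
    -- `‖∑‖ ≤ L`, hence `ηK ≤ L` and `ηL ≤ ‖∑‖`
    have hnormL : ‖∑ n ∈ Ioc K (K + L), (𝐞 ((α * ((w : ℝ) ^ 2 - (w' : ℝ) ^ 2)) * (n : ℝ) ^ 2 +
        (β * ((w : ℝ) - w')) * n) : ℂ)‖ ≤ L := by
      calc ‖∑ n ∈ Ioc K (K + L), (𝐞 ((α * ((w : ℝ) ^ 2 - (w' : ℝ) ^ 2)) * (n : ℝ) ^ 2 +
            (β * ((w : ℝ) - w')) * n) : ℂ)‖
          ≤ ∑ n ∈ Ioc K (K + L), ‖(𝐞 ((α * ((w : ℝ) ^ 2 - (w' : ℝ) ^ 2)) * (n : ℝ) ^ 2 +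
            (β * ((w : ℝ) - w')) * n) : ℂ)‖ := norm_sum_le _ _
        _ = ∑ _n ∈ Ioc K (K + L), (1 : ℝ) := Finset.sum_congr rfl fun n _ =>
            Literature.NumberTheory.Sieve.Vinogradov.norm_fourierChar _
        _ = L := by
            rw [Finset.sum_const, Nat.card_Ioc, nsmul_eq_mul, mul_one]
            have : K + L - K = L := by omega
            rw [this]
    have hηKL : η * K ≤ L := hS.trans hnormL
    have hS' : η * L ≤ ‖∑ n ∈ Ioc K (K + L), (𝐞 ((α * ((w : ℝ) ^ 2 - (w' : ℝ) ^ 2)) * (n : ℝ) ^ 2 +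
        (β * ((w : ℝ) - w')) * n) : ℂ)‖ :=
      le_trans (mul_le_mul_of_nonneg_left hLKr hη.le) hS
    obtain ⟨k, hk1, hkK, hdist⟩ := hW η K L _ _ hη hη1 hL1 hS'
    refine ⟨k, hk1, hkK, hdist.trans ?_⟩
    rw [← hK₂]
    have h0 : 0 < η * K := by positivity
    exact div_le_div_of_nonneg_left hK₂0.le (by positivity)
      (by rw [← mul_pow]; exact pow_le_pow_left₀ h0.le hηKL 2)
  choose! kf hkf1 hkfK hkfd using hWeyl
  -- Step 2: pigeonhole the `k_w`
  set Kn : ℕ := ⌊K₂⌋₊ with hKn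
  have hKn1 : 1 ≤ Kn := by rw [hKn]; exact Nat.le_floor (by simpa using hK₂1)
  have hKnle : (Kn : ℝ) ≤ K₂ := Nat.floor_le hK₂0.le
  obtain ⟨k₀, hk₀1, hk₀K, hpop⟩ := exists_popular_label B kf hKn1 fun w hw =>
    ⟨hkf1 w hw, Nat.le_floor (hkfK w hw)⟩
  set G := B.filter (fun w => kf w = k₀) with hGdef
  have hGcard : c * (M : ℝ) ≤ #G := by
    refine le_trans ?_ hpop
    have hKn0 : (0 : ℝ) < Kn := by exact_mod_cast hKn1
    rw [le_div_iff₀ hKn0]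
    calc c * (M : ℝ) * Kn ≤ c * M * K₂ := mul_le_mul_of_nonneg_left hKnle (by positivity)
      _ = η * M / 2 := by rw [hcdef]; field_simp
      _ ≤ #B := hBcard
  have hGsub : G ⊆ Icc 1 M := by
    intro w hw
    have hw' := (Finset.mem_filter.mp (Finset.mem_filter.mp hw).1).1
    exact hw'
  set ε : ℝ := K₂ / (η ^ 2 * (K : ℝ) ^ 2) with hεdef
  have hε0 : 0 < ε := by positivity
  have hGgood : ∀ w ∈ G, distInt ((k₀ : ℝ) * α * (w : ℝ) ^ 2 - (k₀ : ℝ) * α * (w' : ℝ) ^ 2) ≤ ε := by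
    intro w hw
    obtain ⟨hwB, hwk⟩ := Finset.mem_filter.mp hw
    have h := hkfd w hwB
    rw [hwk] at h
    have e : (k₀ : ℝ) * α * (w : ℝ) ^ 2 - (k₀ : ℝ) * α * (w' : ℝ) ^ 2 =
        (k₀ : ℝ) * (α * ((w : ℝ) ^ 2 - (w' : ℝ) ^ 2)) := by ring
    rw [e]; exact h
  have hεc : 2 ^ 11 * ε ≤ c ^ 2 := by
    have hpos : (0 : ℝ) < η ^ 2 * (K : ℝ) ^ 2 := by positivity
    rw [hεdef, ← mul_div_assoc, div_le_iff₀ hpos]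
    calc 2 ^ 11 * K₂ ≤ c ^ 2 * η ^ 2 * (K : ℝ) ^ 2 := hl3
      _ = c ^ 2 * (η ^ 2 * (K : ℝ) ^ 2) := by ring
  have hMlarge : (2 : ℝ) ^ 25 ≤ c ^ 8 * M := by rw [hcdef, hMdef]; exact hl2
  -- Step 3: clear `w² − w'²`
  obtain ⟨q', hq'1, hq'le, hq'dist⟩ := exists_distInt_mul_le_of_sq_recurrent (κ := k₀ * α)
    (θ := k₀ * α * (w' : ℝ) ^ 2) hc0 hc1 hε0 G hGsub hGcard hGgood hMlarge hεc
  refine ⟨q' * k₀, Nat.one_le_iff_ne_zero.mpr (Nat.mul_ne_zero (by omega) (by omega)), ?_, ?_⟩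
  · have hk₀r : (k₀ : ℝ) ≤ K₂ := le_trans (by exact_mod_cast hk₀K) hKnle
    push_cast
    calc (q' : ℝ) * k₀ ≤ 2 ^ 17 / c ^ 6 * K₂ :=
          mul_le_mul hq'le hk₀r (Nat.cast_nonneg _) (by positivity)
      _ = 2 ^ 17 * (1 / c) ^ 6 * K₂ := by rw [one_div_pow]; ring
      _ ≤ 2 ^ 17 * s ^ 6 * s := by
          refine mul_le_mul (mul_le_mul_of_nonneg_left
            (pow_le_pow_left₀ (by positivity) hcs' 6) (by norm_num)) hKs hK₂0.le (by positivity)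
      _ = 2 ^ 17 * s ^ 7 := by ring
      _ ≤ 2 ^ 52 * s ^ 17 :=
          mul_le_mul (by norm_num) (pow_le_pow_right₀ hs1 (by norm_num)) (by positivity)
            (by positivity)
  · have e : ((q' * k₀ : ℕ) : ℝ) * α = (q' : ℝ) * (k₀ * α) := by push_cast; ring
    rw [e]
    refine hq'dist.trans ?_
    -- `2^42/c^12 · ε/M² ≤ 2^44 s^15 / N²`
    have hKM2 : (N : ℝ) ^ 2 / 4 ≤ ((K : ℝ) * M) ^ 2 := by
      have := pow_le_pow_left₀ (by positivity) hKM 2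
      calc (N : ℝ) ^ 2 / 4 = ((N : ℝ) / 2) ^ 2 := by ring
        _ ≤ _ := this
    have hN2 : (0 : ℝ) < (N : ℝ) ^ 2 := by positivity
    have h1 : ε / (M : ℝ) ^ 2 ≤ 4 * K₂ * (1 / η) ^ 2 / (N : ℝ) ^ 2 := by
      rw [hεdef, div_div, one_div_pow, show η ^ 2 * (K : ℝ) ^ 2 * (M : ℝ) ^ 2 =
        η ^ 2 * ((K : ℝ) * M) ^ 2 by ring]
      rw [div_le_div_iff₀ (by positivity) hN2]
      have : K₂ * (N : ℝ) ^ 2 ≤ K₂ * (4 * ((K : ℝ) * M) ^ 2) :=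
        mul_le_mul_of_nonneg_left (by linarith) hK₂0.le
      calc K₂ * (N : ℝ) ^ 2 ≤ K₂ * (4 * ((K : ℝ) * M) ^ 2) := this
        _ = 4 * K₂ * (1 / η ^ 2) * (η ^ 2 * ((K : ℝ) * M) ^ 2) := by field_simp
    calc 2 ^ 42 / c ^ 12 * ε / (M : ℝ) ^ 2 = 2 ^ 42 * (1 / c) ^ 12 * (ε / (M : ℝ) ^ 2) := by
          rw [one_div_pow]; ring
      _ ≤ 2 ^ 42 * s ^ 12 * (4 * K₂ * (1 / η) ^ 2 / (N : ℝ) ^ 2) := by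
          refine mul_le_mul (mul_le_mul_of_nonneg_left
            (pow_le_pow_left₀ (by positivity) hcs' 12) (by norm_num)) h1 (by positivity)
            (by positivity)
      _ = 2 ^ 44 * (s ^ 12 * (K₂ * (1 / η) ^ 2)) / (N : ℝ) ^ 2 := by ring
      _ ≤ 2 ^ 44 * (s ^ 12 * (s * s ^ 2)) / (N : ℝ) ^ 2 := by
          refine div_le_div_of_nonneg_right (mul_le_mul_of_nonneg_left
            (mul_le_mul_of_nonneg_left ?_ (by positivity)) (by norm_num)) hN2.le
          exact mul_le_mul hKs (pow_le_pow_left₀ (by positivity) hηs' 2) (by positivity) hs0.le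
      _ = 2 ^ 44 * s ^ 15 / (N : ℝ) ^ 2 := by ring
      _ ≤ 2 ^ 52 * s ^ 17 / (N : ℝ) ^ 2 := by
          refine div_le_div_of_nonneg_right ?_ hN2.le
          exact mul_le_mul (by norm_num) (pow_le_pow_right₀ hs1 (by norm_num)) (by positivity)
            (by positivity)

/-! ### Assembly: correlation with a quadratic phase implies major arc -/

/-- Logarithmic bookkeeping: `log₂ N + 1 ≤ 2(1 + log N)` and `1 + log(2N) ≤ 2(1 + log N)` for
`N ≥ 2`. [folklore] -/
private theorem log_bookkeeping {N : ℕ} (hN : 2 ≤ N) :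
    ((Nat.log 2 N : ℝ) + 1 ≤ 2 * (1 + Real.log N)) ∧
      (1 + Real.log (2 * (N : ℝ)) ≤ 2 * (1 + Real.log N)) := by
  have hN0 : N ≠ 0 := by omega
  have hNr : (0 : ℝ) < N := by exact_mod_cast Nat.pos_of_ne_zero hN0
  have hlog2 := Real.log_two_gt_d9
  have hlog2' := Real.log_two_lt_d9
  have hL : Real.log 2 ≤ Real.log N := Real.log_le_log (by norm_num) (by exact_mod_cast hN)
  constructor
  · have h1 : ((Nat.log 2 N : ℕ) : ℝ) * Real.log 2 ≤ Real.log N := by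
      rw [← Real.log_pow]
      exact Real.log_le_log (by positivity) (by exact_mod_cast Nat.pow_log_le_self 2 hN0)
    nlinarith
  · rw [Real.log_mul (by norm_num) hNr.ne']
    linarith

/-- The numerical bookkeeping of the minor-arc argument (choice of `η₁ = δ/(64Λ³)`,
`η₂ = δ²/(2048Λ⁵)`, `Λ = (1 + log N)/δ`, and the largeness conditions in terms of
`u ≥ 2²⁵ s¹⁴`, `u³ ≤ N`). [folklore] -/
private theorem aux_params {A : ℕ} {C : ℝ} (hC1 : 1 ≤ C) {N : ℕ} (hN : 2 ≤ N) {δ : ℝ}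
    (hδ : 0 < δ) (hδ1 : δ ≤ 1) {t s : ℝ} (ht : 2 ^ 11 * ((1 + Real.log N) / δ) ^ 7 ≤ t)
    (hst : 2 * t ^ 2 * (C * (8 * t ^ 2) ^ A) ≤ s)
    {u : ℕ} (huN : u ^ 3 ≤ N) (hularge : 2 ^ 25 * s ^ 14 ≤ (u : ℝ))
    {η₁ η₂ : ℝ} (hη₁ : η₁ = δ / (64 * ((1 + Real.log N) / δ) ^ 3))
    (hη₂ : η₂ = δ ^ 2 / (2048 * ((1 + Real.log N) / δ) ^ 5)) :
    (0 < η₁ ∧ η₁ ≤ 1 ∧ 0 < η₂ ∧ η₂ ≤ 1 ∧ 1 ≤ s) ∧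
    (C * (8 / η₁ ^ 2) ^ A ≤ s ∧ 2 * (C * (8 / η₁ ^ 2) ^ A) ≤ η₁ ^ 2 * s ∧
      C * (8 / η₂ ^ 2) ^ A ≤ s ∧ 2 * (C * (8 / η₂ ^ 2) ^ A) ≤ η₂ * s) ∧
    (2 ≤ u ∧ 1 ≤ u * u ∧ u * u ≤ N ∧ 2 * (u : ℝ) ≤ δ * N / 2) ∧
    (64 * η₁ ^ 2 * (N : ℝ) ^ 2 * (1 + Real.log ((u * u : ℕ) : ℝ)) ^ 4 *
        (Nat.log 2 (u * u) + 1) ≤ (δ * N / 4) ^ 2 ∧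
      2 ^ 15 * (C * (8 / η₁ ^ 2) ^ A) * ((u * u : ℕ) : ℝ) ^ 2 ≤
        (η₁ ^ 2 / (2 * (C * (8 / η₁ ^ 2) ^ A))) ^ 2 * (N : ℝ) ^ 2) ∧
    (4 * η₂ * (N : ℝ) ^ 2 * ((Nat.log 2 N : ℝ) + 1) ^ 2 * (1 + Real.log (2 * N)) ^ 3 ≤
        (δ * N / 4) ^ 2 ∧
      2 ≤ η₂ * u ∧ (2 : ℝ) ^ 25 ≤ (η₂ / (2 * (C * (8 / η₂ ^ 2) ^ A))) ^ 8 * u ∧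
      2 ^ 11 * (C * (8 / η₂ ^ 2) ^ A) ≤
        (η₂ / (2 * (C * (8 / η₂ ^ 2) ^ A))) ^ 2 * η₂ ^ 2 * (u : ℝ) ^ 2) := by
  have hN0 : N ≠ 0 := by omega
  have hNr : (0 : ℝ) < N := by exact_mod_cast Nat.pos_of_ne_zero hN0
  have hN1 : (1 : ℝ) ≤ N := by exact_mod_cast Nat.one_le_iff_ne_zero.mpr hN0
  obtain ⟨Lg, hLg⟩ : ∃ Lg : ℝ, Lg = Real.log N := ⟨_, rfl⟩
  have hLg2 : 1 / 2 < Lg := by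
    rw [hLg]; exact Literature.NumberTheory.Sieve.Vinogradov.half_lt_log hN
  have hLg0 : 0 < Lg := by linarith only [hLg2]
  obtain ⟨Lam, hLam⟩ : ∃ Lam : ℝ, Lam = (1 + Real.log N) / δ := ⟨_, rfl⟩
  rw [← hLam] at ht hη₁ hη₂
  rw [← hLg] at hLam
  have hLam1 : 1 + Lg ≤ Lam := by
    rw [hLam, le_div_iff₀ hδ]; exact mul_le_of_le_one_right (by linarith only [hLg2]) hδ1
  have hLam1' : 1 ≤ Lam := by linarith only [hLam1, hLg0]
  have hLam0 : 0 < Lam := by linarith only [hLam1']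
  have hLamδ : 1 ≤ Lam * δ := by
    rw [hLam, div_mul_cancel₀ _ hδ.ne']; linarith only [hLg0]
  obtain ⟨hlogA, hlogB⟩ := log_bookkeeping hN
  rw [← hLg] at hlogA hlogB
  have hη₁0 : 0 < η₁ := by rw [hη₁]; positivity
  have hη₂0 : 0 < η₂ := by rw [hη₂]; positivity
  have hΛ3 : (1 : ℝ) ≤ Lam ^ 3 := one_le_pow₀ hLam1'
  have hΛ5 : (1 : ℝ) ≤ Lam ^ 5 := one_le_pow₀ hLam1'
  have hδ21 : δ ^ 2 ≤ 1 := pow_le_one₀ hδ.le hδ1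
  have hη₁1 : η₁ ≤ 1 := by
    rw [hη₁, div_le_one (by positivity)]; linarith only [hδ1, hΛ3]
  have hη₂1 : η₂ ≤ 1 := by
    rw [hη₂, div_le_one (by positivity)]; linarith only [hδ21, hΛ5]
  -- `1/η₁, 1/η₂ ≤ t`, in the form `1 ≤ η t`
  have ht₁ : 1 ≤ η₁ * t := by
    have h1 : η₁ * (2 ^ 11 * Lam ^ 7) = 32 * Lam ^ 3 * (Lam * δ) := by
      rw [hη₁]; field_simp; ring
    have h2 : (1 : ℝ) ≤ 32 * Lam ^ 3 * (Lam * δ) :=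
      one_le_mul_of_one_le_of_one_le (by linarith only [hΛ3]) hLamδ
    calc (1 : ℝ) ≤ η₁ * (2 ^ 11 * Lam ^ 7) := by rw [h1]; exact h2
      _ ≤ η₁ * t := mul_le_mul_of_nonneg_left ht hη₁0.le
  have ht₂ : 1 ≤ η₂ * t := by
    have h1 : η₂ * (2 ^ 11 * Lam ^ 7) = (Lam * δ) ^ 2 := by rw [hη₂]; field_simp; ring
    have h2 : (1 : ℝ) ≤ (Lam * δ) ^ 2 := one_le_pow₀ hLamδ
    calc (1 : ℝ) ≤ η₂ * (2 ^ 11 * Lam ^ 7) := by rw [h1]; exact h2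
      _ ≤ η₂ * t := mul_le_mul_of_nonneg_left ht hη₂0.le
  have ht0 : 0 < t := lt_of_lt_of_le (by positivity) ht
  have ht1 : 1 ≤ t := by
    calc (1 : ℝ) ≤ η₁ * t := ht₁
      _ ≤ 1 * t := mul_le_mul_of_nonneg_right hη₁1 ht0.le
      _ = t := one_mul t
  have ht21 : 1 ≤ t ^ 2 := one_le_pow₀ ht1
  obtain ⟨Kt, hKt⟩ : ∃ Kt : ℝ, Kt = C * (8 * t ^ 2) ^ A := ⟨_, rfl⟩
  have hηt : ∀ η : ℝ, 0 < η → 1 ≤ η * t → C * (8 / η ^ 2) ^ A ≤ Kt := by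
    intro η hη h
    rw [hKt]
    refine mul_le_mul_of_nonneg_left (pow_le_pow_left₀ (by positivity) ?_ A)
      (by linarith only [hC1])
    rw [div_le_iff₀ (by positivity)]
    have : (1 : ℝ) ≤ (η * t) ^ 2 := one_le_pow₀ h
    calc (8 : ℝ) = 8 * 1 := by ring
      _ ≤ 8 * (η * t) ^ 2 := by linarith only [this]
      _ = 8 * t ^ 2 * η ^ 2 := by ring
  have hKt1 : 1 ≤ Kt := by
    rw [hKt]; exact one_le_mul_of_one_le_of_one_le hC1 (one_le_pow₀ (by linarith only [ht21]))
  have hKt0 : 0 < Kt := by linarith only [hKt1]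
  rw [← hKt] at hst
  have h2t : (1 : ℝ) ≤ 2 * t ^ 2 := by linarith only [ht21]
  have hsKt : Kt ≤ s := le_trans (le_mul_of_one_le_left hKt0.le h2t) hst
  have hs1 : 1 ≤ s := hKt1.trans hsKt
  have hs0 : 0 < s := by linarith only [hs1]
  have h2tu : 2 * t ≤ 2 * t ^ 2 * Kt := by
    calc 2 * t = 2 * t * 1 * 1 := by ring
      _ ≤ 2 * t * t * Kt := mul_le_mul (mul_le_mul_of_nonneg_left ht1 (by positivity)) hKt1
          zero_le_one (by positivity)
      _ = 2 * t ^ 2 * Kt := by ring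
  have hts : t ≤ s := by linarith only [h2tu, hst, ht0]
  -- the two Weyl constants
  obtain ⟨K₁, hK₁def⟩ : ∃ K₁ : ℝ, K₁ = C * (8 / η₁ ^ 2) ^ A := ⟨_, rfl⟩
  obtain ⟨K₂, hK₂def⟩ : ∃ K₂ : ℝ, K₂ = C * (8 / η₂ ^ 2) ^ A := ⟨_, rfl⟩
  have hK₁ : K₁ ≤ Kt := by rw [hK₁def]; exact hηt η₁ hη₁0 ht₁
  have hK₂ : K₂ ≤ Kt := by rw [hK₂def]; exact hηt η₂ hη₂0 ht₂
  rw [← hK₁def, ← hK₂def]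
  have h8 : ∀ η : ℝ, 0 < η → η ≤ 1 → (1 : ℝ) ≤ 8 / η ^ 2 := by
    intro η hη hη1
    rw [le_div_iff₀ (by positivity)]
    have : η ^ 2 ≤ 1 := pow_le_one₀ hη.le hη1
    linarith only [this]
  have hK₁1 : 1 ≤ K₁ := by
    rw [hK₁def]; exact one_le_mul_of_one_le_of_one_le hC1 (one_le_pow₀ (h8 η₁ hη₁0 hη₁1))
  have hK₂1 : 1 ≤ K₂ := by
    rw [hK₂def]; exact one_le_mul_of_one_le_of_one_le hC1 (one_le_pow₀ (h8 η₂ hη₂0 hη₂1))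
  have hK₁0 : 0 < K₁ := by linarith only [hK₁1]
  have hK₂0 : 0 < K₂ := by linarith only [hK₂1]
  have hKs₁ : K₁ ≤ s := hK₁.trans hsKt
  have hKs₂ : K₂ ≤ s := hK₂.trans hsKt
  have hcs₁ : 2 * K₁ ≤ η₁ ^ 2 * s := by
    have h2 : (1 : ℝ) ≤ η₁ ^ 2 * t ^ 2 := by rw [← mul_pow]; exact one_le_pow₀ ht₁
    calc 2 * K₁ ≤ 2 * Kt := by linarith only [hK₁]
      _ ≤ (η₁ ^ 2 * t ^ 2) * (2 * Kt) := le_mul_of_one_le_left (by positivity) h2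
      _ = η₁ ^ 2 * (2 * t ^ 2 * Kt) := by ring
      _ ≤ η₁ ^ 2 * s := mul_le_mul_of_nonneg_left hst (by positivity)
  have hcs₂ : 2 * K₂ ≤ η₂ * s := by
    have h2 : (1 : ℝ) ≤ η₂ * t ^ 2 := by
      calc (1 : ℝ) = 1 * 1 := by ring
        _ ≤ (η₂ * t) * t := mul_le_mul ht₂ ht1 zero_le_one (by positivity)
        _ = η₂ * t ^ 2 := by ring
    calc 2 * K₂ ≤ 2 * Kt := by linarith only [hK₂]
      _ ≤ (η₂ * t ^ 2) * (2 * Kt) := le_mul_of_one_le_left (by positivity) h2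
      _ = η₂ * (2 * t ^ 2 * Kt) := by ring
      _ ≤ η₂ * s := mul_le_mul_of_nonneg_left hst (by positivity)
  have hc₁ : 1 / s ≤ η₁ ^ 2 / (2 * K₁) := by
    rw [div_le_div_iff₀ hs0 (by positivity)]; linarith only [hcs₁]
  have hc₂ : 1 / s ≤ η₂ / (2 * K₂) := by
    rw [div_le_div_iff₀ hs0 (by positivity)]; linarith only [hcs₂]
  have hη₂s : 1 / s ≤ η₂ := by
    rw [div_le_iff₀ hs0]; linarith only [hcs₂, hK₂1]
  -- sizes of `u`
  have hs14 : s ≤ 2 ^ 25 * s ^ 14 := by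
    calc s = 1 * s ^ 1 := by ring
      _ ≤ 2 ^ 25 * s ^ 14 :=
        mul_le_mul (by norm_num) (pow_le_pow_right₀ hs1 (by norm_num)) (by positivity)
          (by positivity)
  have hus : s ≤ u := hs14.trans hularge
  have hut : t ≤ u := hts.trans hus
  have hu2r : (2 : ℝ) ≤ u := by
    have : (1 : ℝ) ≤ s ^ 14 := one_le_pow₀ hs1
    linarith only [this, hularge]
  have hu2 : 2 ≤ u := by exact_mod_cast hu2r
  have hu1 : 1 ≤ u := by omega
  have hur : (0 : ℝ) < u := by linarith only [hu2r]
  have huNr : (u : ℝ) ^ 3 ≤ N := by exact_mod_cast huN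
  have hUN : u * u ≤ N := by
    refine le_trans ?_ huN
    calc u * u = u ^ 2 := (sq u).symm
      _ ≤ u ^ 3 := Nat.pow_le_pow_right hu1 (by norm_num)
  have hUU1 : 1 ≤ u * u := by
    calc 1 = 1 * 1 := (mul_one 1).symm
      _ ≤ u * u := Nat.mul_le_mul hu1 hu1
  -- `2u ≤ δN/2`: `δ u ≥ δ t ≥ 4`, `N ≥ u³`
  have hδu : 4 ≤ δ * u := by
    have h1 : 4 ≤ δ * t := by
      have e : η₁ * t = δ * t / (64 * Lam ^ 3) := by rw [hη₁]; ring
      have h := ht₁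
      rw [e, le_div_iff₀ (by positivity)] at h
      linarith only [h, hΛ3]
    exact h1.trans (mul_le_mul_of_nonneg_left hut hδ.le)
  have h2u : 2 * (u : ℝ) ≤ δ * N / 2 := by
    have h3 : δ * (u : ℝ) ^ 3 ≤ δ * N := mul_le_mul_of_nonneg_left huNr hδ.le
    have h4 : 4 * (u : ℝ) ≤ δ * (u : ℝ) ^ 3 := by
      have hu1r : (1 : ℝ) ≤ u := by exact_mod_cast hu1
      calc 4 * (u : ℝ) = 4 * u * 1 := by ring
        _ ≤ (δ * u) * u * u :=
            mul_le_mul (mul_le_mul_of_nonneg_right hδu hur.le) hu1r zero_le_one (by positivity)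
        _ = δ * (u : ℝ) ^ 3 := by ring
    linarith only [h3, h4]
  refine ⟨⟨hη₁0, hη₁1, hη₂0, hη₂1, hs1⟩, ⟨hKs₁, hcs₁, hKs₂, hcs₂⟩, ⟨hu2, hUU1, hUN, h2u⟩,
    ⟨?_, ?_⟩, ⟨?_, ?_, ?_, ?_⟩⟩
  · -- type I threshold
    have h1 : 1 + Real.log ((u * u : ℕ) : ℝ) ≤ Lam := by
      refine le_trans ?_ hLam1
      have : Real.log ((u * u : ℕ) : ℝ) ≤ Lg := by
        rw [hLg]; exact Real.log_le_log (by positivity) (by exact_mod_cast hUN)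
      linarith only [this]
    have h1' : 0 ≤ 1 + Real.log ((u * u : ℕ) : ℝ) := by
      have hUU1r : (1 : ℝ) ≤ ((u * u : ℕ) : ℝ) := by exact_mod_cast hUU1
      have := Real.log_nonneg hUU1r
      linarith only [this]
    have h2 : ((Nat.log 2 (u * u) : ℕ) : ℝ) + 1 ≤ 2 * Lam := by
      have : ((Nat.log 2 (u * u) : ℕ) : ℝ) ≤ Nat.log 2 N := by
        exact_mod_cast Nat.log_mono_right hUN
      linarith only [this, hlogA, hLam1]
    have h4 : (1 + Real.log ((u * u : ℕ) : ℝ)) ^ 4 ≤ Lam ^ 4 := pow_le_pow_left₀ h1' h1 4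
    calc 64 * η₁ ^ 2 * (N : ℝ) ^ 2 * (1 + Real.log ((u * u : ℕ) : ℝ)) ^ 4 *
          (Nat.log 2 (u * u) + 1)
        ≤ 64 * η₁ ^ 2 * (N : ℝ) ^ 2 * Lam ^ 4 * (2 * Lam) := by
          refine mul_le_mul (mul_le_mul_of_nonneg_left h4 (by positivity)) h2 (by positivity)
            (by positivity)
      _ = δ ^ 2 * (N : ℝ) ^ 2 / (32 * Lam) := by rw [hη₁]; field_simp; ring
      _ ≤ δ ^ 2 * (N : ℝ) ^ 2 / 16 := by
          rw [div_le_div_iff_of_pos_left (by positivity) (by positivity) (by norm_num)]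
          linarith only [hLam1']
      _ = (δ * N / 4) ^ 2 := by ring
  · -- `2^15 K₁ U² ≤ c₁² N²`
    have hU2 : (((u * u : ℕ) : ℝ)) ^ 2 = (u : ℝ) ^ 4 := by push_cast; ring
    rw [hU2]
    have h1 : (1 / s) ^ 2 * (N : ℝ) ^ 2 ≤ (η₁ ^ 2 / (2 * K₁)) ^ 2 * (N : ℝ) ^ 2 :=
      mul_le_mul_of_nonneg_right (pow_le_pow_left₀ (by positivity) hc₁ 2) (by positivity)
    refine le_trans ?_ h1
    have h2 : (u : ℝ) ^ 6 ≤ (N : ℝ) ^ 2 := by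
      calc (u : ℝ) ^ 6 = ((u : ℝ) ^ 3) ^ 2 := by ring
        _ ≤ (N : ℝ) ^ 2 := pow_le_pow_left₀ (by positivity) huNr 2
    have h3 : 2 ^ 15 * s ^ 3 ≤ (u : ℝ) := by
      refine le_trans ?_ hularge
      exact mul_le_mul (by norm_num) (pow_le_pow_right₀ hs1 (by norm_num)) (by positivity)
        (by positivity)
    rw [one_div_pow, div_mul_eq_mul_div, one_mul, le_div_iff₀ (by positivity)]
    calc 2 ^ 15 * K₁ * (u : ℝ) ^ 4 * s ^ 2 ≤ 2 ^ 15 * s * (u : ℝ) ^ 4 * s ^ 2 := by gcongr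
      _ = (2 ^ 15 * s ^ 3) * (u : ℝ) ^ 4 := by ring
      _ ≤ u * (u : ℝ) ^ 4 := mul_le_mul_of_nonneg_right h3 (by positivity)
      _ = (u : ℝ) ^ 5 * 1 := by ring
      _ ≤ (u : ℝ) ^ 5 * u := mul_le_mul_of_nonneg_left (by linarith only [hu2r]) (by positivity)
      _ = (u : ℝ) ^ 6 := by ring
      _ ≤ (N : ℝ) ^ 2 := h2
  · -- type II threshold
    have h1 : ((Nat.log 2 N : ℝ) + 1) ^ 2 ≤ (2 * Lam) ^ 2 :=
      pow_le_pow_left₀ (by positivity) (hlogA.trans (by linarith only [hLam1])) 2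
    have h2' : 0 ≤ 1 + Real.log (2 * (N : ℝ)) := by
      have := Real.log_nonneg (show (1 : ℝ) ≤ 2 * N by linarith only [hN1]); linarith only [this]
    have h2 : (1 + Real.log (2 * (N : ℝ))) ^ 3 ≤ (2 * Lam) ^ 3 :=
      pow_le_pow_left₀ h2' (hlogB.trans (by linarith only [hLam1])) 3
    calc 4 * η₂ * (N : ℝ) ^ 2 * ((Nat.log 2 N : ℝ) + 1) ^ 2 * (1 + Real.log (2 * N)) ^ 3
        ≤ 4 * η₂ * (N : ℝ) ^ 2 * (2 * Lam) ^ 2 * (2 * Lam) ^ 3 :=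
          mul_le_mul (mul_le_mul_of_nonneg_left h1 (by positivity)) h2 (pow_nonneg h2' 3)
            (by positivity)
      _ = (δ * N / 4) ^ 2 := by rw [hη₂]; field_simp; ring
  · -- `2 ≤ η₂ u`
    have h1 : 2 * t ≤ u := by linarith only [h2tu, hst, hus]
    calc (2 : ℝ) ≤ 2 * (η₂ * t) := by linarith only [ht₂]
      _ = η₂ * (2 * t) := by ring
      _ ≤ η₂ * u := mul_le_mul_of_nonneg_left h1 hη₂0.le
  · -- `2^25 ≤ c₂⁸ u`
    have h1 : (1 / s) ^ 8 * u ≤ (η₂ / (2 * K₂)) ^ 8 * u :=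
      mul_le_mul_of_nonneg_right (pow_le_pow_left₀ (by positivity) hc₂ 8) hur.le
    refine le_trans ?_ h1
    rw [one_div_pow, div_mul_eq_mul_div, one_mul, le_div_iff₀ (by positivity)]
    calc (2 : ℝ) ^ 25 * s ^ 8 ≤ 2 ^ 25 * s ^ 14 :=
          mul_le_mul_of_nonneg_left (pow_le_pow_right₀ hs1 (by norm_num)) (by positivity)
      _ ≤ u := hularge
  · -- `2^11 K₂ ≤ c₂² η₂² u²`
    have h1 : ((1 / s) ^ 2 * (1 / s) ^ 2) * (u : ℝ) ^ 2 ≤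
        ((η₂ / (2 * K₂)) ^ 2 * η₂ ^ 2) * (u : ℝ) ^ 2 :=
      mul_le_mul_of_nonneg_right (mul_le_mul (pow_le_pow_left₀ (by positivity) hc₂ 2)
        (pow_le_pow_left₀ (by positivity) hη₂s 2) (by positivity) (by positivity)) (by positivity)
    refine le_trans ?_ h1
    have e : ((1 / s) ^ 2 * (1 / s) ^ 2) * (u : ℝ) ^ 2 = (u : ℝ) ^ 2 / s ^ 4 := by
      field_simp
    rw [e, le_div_iff₀ (by positivity)]
    have h3 : (u : ℝ) * (2 ^ 25 * s ^ 14) ≤ (u : ℝ) ^ 2 := by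
      rw [sq]; exact mul_le_mul_of_nonneg_left hularge hur.le
    calc 2 ^ 11 * K₂ * s ^ 4 ≤ 2 ^ 11 * s * s ^ 4 := by gcongr
      _ = 1 * (2 ^ 11 * s ^ 5) := by ring
      _ ≤ u * (2 ^ 25 * s ^ 14) :=
          mul_le_mul (by linarith only [hu2r]) (mul_le_mul (by norm_num)
            (pow_le_pow_right₀ hs1 (by norm_num)) (by positivity) (by positivity)) (by positivity)
            hur.le
      _ ≤ (u : ℝ) ^ 2 := h3

/-- **Correlation with a quadratic phase implies major arc** (Green–Tao, AIF 2008, §7,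
Propositions 7.1–7.2 = arXiv Props. 16–17), for `N` large: with `Λ = (1 + log N)/δ`, `t ≥ 2¹¹Λ⁷`
and `s ≥ 2t² · C(8t²)^A` (`A, C` the constants of the quadratic Weyl inequality), if
`u³ ≤ N`, `u ≥ 2²⁵ s¹⁴` and `|∑_{n ≤ N} μ(n) e(αn² + βn)| ≥ δN`, then some `1 ≤ q ≤ 2⁵² s¹⁷` has
`‖qα‖_{ℝ/ℤ} ≤ 2⁵² s¹⁷/N²`. Vaughan's identity with `U = V = u`; the type I / type II inverse
theorems with `η₁ = δ/(64Λ³)`, `η₂ = δ²/(2048Λ⁵)`; then `typeI_case_denominator` /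
`typeII_case_denominator`. [cite: GreenTao2008QuadraticMobius, §7, Propositions 7.1–7.2] -/
theorem exists_denominator_of_large_quadratic_moebius_sum_aux {A : ℕ} {C : ℝ} (hC1 : 1 ≤ C)
    (hW : ∀ (η : ℝ) (a L : ℕ) (θ₂ θ₁ : ℝ), 0 < η → η ≤ 1 → 1 ≤ L →
        η * L ≤ ‖∑ n ∈ Ioc a (a + L), (𝐞 (θ₂ * (n : ℝ) ^ 2 + θ₁ * n) : ℂ)‖ →
        ∃ k : ℕ, 1 ≤ k ∧ (k : ℝ) ≤ C * (8 / η ^ 2) ^ A ∧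
          distInt (k * θ₂) ≤ C * (8 / η ^ 2) ^ A / (L : ℝ) ^ 2)
    {N : ℕ} (hN : 2 ≤ N) {δ : ℝ} (hδ : 0 < δ) (hδ1 : δ ≤ 1) (α β : ℝ)
    (hS : δ * N ≤ ‖∑ n ∈ Icc 1 N, ((μ n : ℝ) : ℂ) * (𝐞 (α * (n : ℝ) ^ 2 + β * n) : ℂ)‖)
    {t s : ℝ} (ht : 2 ^ 11 * ((1 + Real.log N) / δ) ^ 7 ≤ t)
    (hst : 2 * t ^ 2 * (C * (8 * t ^ 2) ^ A) ≤ s)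
    {u : ℕ} (huN : u ^ 3 ≤ N) (hularge : 2 ^ 25 * s ^ 14 ≤ (u : ℝ)) :
    ∃ q : ℕ, 1 ≤ q ∧ (q : ℝ) ≤ 2 ^ 52 * s ^ 17 ∧
      distInt (q * α) ≤ 2 ^ 52 * s ^ 17 / (N : ℝ) ^ 2 := by
  classical
  set η₁ : ℝ := δ / (64 * ((1 + Real.log N) / δ) ^ 3) with hη₁
  set η₂ : ℝ := δ ^ 2 / (2048 * ((1 + Real.log N) / δ) ^ 5) with hη₂
  obtain ⟨⟨hη₁0, hη₁1, hη₂0, hη₂1, hs1⟩, ⟨hKs₁, hcs₁, hKs₂, hcs₂⟩, ⟨hu2, hUU1, hUN, h2u⟩,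
    ⟨hthrI, hlargeI'⟩, ⟨hthrII, hl1, hl2, hl3⟩⟩ :=
    aux_params hC1 hN hδ hδ1 ht hst huN hularge hη₁ hη₂
  have hu1 : 1 ≤ u := by omega
  -- the phase and Vaughan's identity
  set F : ℕ → ℂ := fun n => (𝐞 (α * (n : ℝ) ^ 2 + β * n) : ℂ) with hFdef
  have hF1 : ∀ n, ‖F n‖ ≤ 1 := fun n => by
    simp only [hFdef]; exact (Literature.NumberTheory.Sieve.Vinogradov.norm_fourierChar _).le
  have hFeq : ∀ n, F n = (𝐞 (α * (n : ℝ) ^ 2 + β * n) : ℂ) := fun n => rfl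
  have hS' : δ * N ≤ ‖∑ n ∈ Icc 1 N, ((μ n : ℝ) : ℂ) * F n‖ := hS
  have hV := norm_sum_moebius_mul_le_vaughan u N F hF1
  clear hS
  generalize hS₀ : ‖∑ n ∈ Icc 1 N, ((μ n : ℝ) : ℂ) * F n‖ = S₀ at hS' hV
  generalize hTI : ‖∑ d ∈ Icc 1 N, ((((moebiusTrunc u : ArithmeticFunction ℝ) *
      (moebiusTrunc u : ArithmeticFunction ℝ)) d : ℝ) : ℂ) * ∑ w ∈ Icc 1 (N / d), F (d * w)‖ = TI
    at hV
  generalize hTII : ‖∑ d ∈ Icc 1 N, ((Literature.NumberTheory.Sieve.Vaughan.gU u d : ℝ) : ℂ) *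
      ∑ w ∈ Icc 1 (N / d), ((((μ : ArithmeticFunction ℝ) -
        (moebiusTrunc u : ArithmeticFunction ℝ)) w : ℝ) : ℂ) * F (d * w)‖ = TII at hV
  have hTT : δ * N / 2 ≤ TI + TII := by linarith
  by_cases hI : δ * N / 4 ≤ TI
  · -- Type I case
    have hlargeI : 64 * η₁ ^ 2 * (N : ℝ) ^ 2 * (1 + Real.log ((u * u : ℕ) : ℝ)) ^ 4 *
        (Nat.log 2 (u * u) + 1) ≤ TI ^ 2 :=
      hthrI.trans (pow_le_pow_left₀ (by positivity) hI 2)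
    rw [← hTI] at hlargeI
    obtain ⟨j, -, hgood⟩ := typeI_inverse (N := N) (U := u * u) hUU1 hUN
      (a := fun d => (((moebiusTrunc u : ArithmeticFunction ℝ) *
          (moebiusTrunc u : ArithmeticFunction ℝ)) d : ℝ))
      (fun d => Literature.NumberTheory.Sieve.MoebiusExpSum.abs_trunc_mul_trunc_le u d)
      (fun d hd => Literature.NumberTheory.Sieve.MoebiusExpSum.trunc_mul_trunc_eq_zero_of_lt hd)
      F hF1 hη₁0 hlargeI
    exact typeI_case_denominator hC1 hW hUU1 hUN α β F hFeq hη₁0 hη₁1 hKs₁ hcs₁ hlargeI' hgood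
  · -- Type II case
    push Not at hI
    have hII : δ * N / 4 ≤ TII := by linarith
    have hlargeII : 4 * η₂ * (N : ℝ) ^ 2 * ((Nat.log 2 N : ℝ) + 1) ^ 2 *
        (1 + Real.log (2 * N)) ^ 3 ≤ TII ^ 2 :=
      hthrII.trans (pow_le_pow_left₀ (by positivity) hII 2)
    rw [← hTII] at hlargeII
    obtain ⟨K, huK, hKu, w', -, hgood⟩ := typeII_inverse (N := N) (u := u) hN hu1
      (b := fun d => (Literature.NumberTheory.Sieve.Vaughan.gU u d : ℝ))
      (c := fun w => (((μ : ArithmeticFunction ℝ) - (moebiusTrunc u : ArithmeticFunction ℝ)) w : ℝ))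
      (fun d => by
        have := Literature.NumberTheory.Sieve.Vaughan.abs_gU_le u d
        rwa [ArithmeticFunction.sigma_zero_apply] at this)
      (fun d hd => Literature.NumberTheory.Sieve.Vaughan.gU_eq_zero_of_le hd)
      (fun w => Literature.NumberTheory.Sieve.MoebiusExpSum.abs_moebius_sub_trunc_le u w)
      (fun w hw => by
        rw [Literature.NumberTheory.Sieve.MoebiusExpSum.moebius_sub_trunc_apply, if_pos hw])
      F hF1 hη₂0 hlargeII
    have hK1 : 1 ≤ K := hu1.trans huK
    have hur : (0 : ℝ) ≤ u := Nat.cast_nonneg u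
    have huKr : (u : ℝ) ≤ K := by exact_mod_cast huK
    have hMu : u ≤ N / K := (Nat.le_div_iff_mul_le hK1).mpr (by rw [mul_comm]; exact hKu)
    have hMur : (u : ℝ) ≤ ((N / K : ℕ) : ℝ) := by exact_mod_cast hMu
    refine typeII_case_denominator hC1 hW hu2 huK hKu α β F hFeq hη₂0 hη₂1 hKs₂ hcs₂
      ?_ ?_ ?_ hgood
    · exact hl1.trans (mul_le_mul_of_nonneg_left hMur hη₂0.le)
    · exact hl2.trans (mul_le_mul_of_nonneg_left hMur (by positivity))
    · exact hl3.trans (mul_le_mul_of_nonneg_left (pow_le_pow_left₀ hur huKr 2) (by positivity))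

/-- Bookkeeping: `2t² · C(8t²)^A = (C 2²³ (2²⁵)^A) Λ^{14A+14}` for `t = 2¹¹Λ⁷`. [folklore] -/
private theorem s_identity (C Lam : ℝ) (A : ℕ) :
    2 * (2 ^ 11 * Lam ^ 7) ^ 2 * (C * (8 * (2 ^ 11 * Lam ^ 7) ^ 2) ^ A) =
      C * 2 ^ 23 * (2 ^ 25) ^ A * Lam ^ (14 * A + 14) := by
  have e1 : (8 : ℝ) * ((2 : ℝ) ^ 11 * Lam ^ 7) ^ 2 = 2 ^ 25 * Lam ^ 14 := by ring
  rw [e1, mul_pow, ← pow_mul, pow_add, pow_mul]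
  ring

/-- Bookkeeping: `((2²⁶ s¹⁴)³)² = 2¹⁵⁶ s⁸⁴`. [folklore] -/
private theorem small_identity (s : ℝ) : (((2 : ℝ) ^ 26 * s ^ 14) ^ 3) ^ 2 = 2 ^ 156 * s ^ 84 := by
  rw [mul_pow, mul_pow, ← pow_mul, ← pow_mul, ← pow_mul, ← pow_mul]

/-- **Correlation with a quadratic phase implies major arc** (Green–Tao, AIF 2008, §7,
Propositions 7.1–7.2 = arXiv Props. 16–17, explicit-existential form): there are `A₀ ∈ ℕ` and
`C₀ ≥ 1` such that for all `N ≥ 2`, `0 < δ ≤ 1` and real `α, β`, if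
`|∑_{n ≤ N} μ(n) e(αn² + βn)| ≥ δN` then some `1 ≤ q ≤ C₀((1 + log N)/δ)^{A₀}` has
`‖qα‖_{ℝ/ℤ} ≤ C₀((1 + log N)/δ)^{A₀}/N²`. (For `N` below a power of `(1 + log N)/δ` the claim is
trivial with `q = 1`; otherwise `exists_denominator_of_large_quadratic_moebius_sum_aux` with
`u = ⌊N^{1/3}⌋`.) [cite: GreenTao2008QuadraticMobius, §7, Propositions 7.1–7.2 (correlation
with quadratic phase implies major arc)] -/
theorem exists_denominator_of_large_quadratic_moebius_sum :
    ∃ (A₀ : ℕ) (C₀ : ℝ), 1 ≤ C₀ ∧ ∀ N : ℕ, 2 ≤ N → ∀ δ : ℝ, 0 < δ → δ ≤ 1 → ∀ α β : ℝ,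
      δ * N ≤ ‖∑ n ∈ Icc 1 N, ((μ n : ℝ) : ℂ) * (𝐞 (α * (n : ℝ) ^ 2 + β * n) : ℂ)‖ →
      ∃ q : ℕ, 1 ≤ q ∧ (q : ℝ) ≤ C₀ * ((1 + Real.log N) / δ) ^ A₀ ∧
        distInt (q * α) ≤ C₀ * ((1 + Real.log N) / δ) ^ A₀ / (N : ℝ) ^ 2 := by
  classical
  obtain ⟨A, C, hC1, hW⟩ := exists_distInt_mul_le_of_norm_quadratic_sum_ge
  obtain ⟨s₀, hs₀⟩ : ∃ s₀ : ℝ, s₀ = C * 2 ^ 23 * (2 ^ 25) ^ A := ⟨_, rfl⟩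
  have hs₀1 : 1 ≤ s₀ := by
    rw [hs₀]
    exact one_le_mul_of_one_le_of_one_le (one_le_mul_of_one_le_of_one_le hC1 (by norm_num))
      (one_le_pow₀ (by norm_num))
  refine ⟨84 * (14 * A + 14), 2 ^ 156 * s₀ ^ 84, ?_, fun N hN δ hδ hδ1 α β hS => ?_⟩
  · exact one_le_mul_of_one_le_of_one_le (by norm_num) (one_le_pow₀ hs₀1)
  have hN0 : N ≠ 0 := by omega
  have hNr : (0 : ℝ) < N := by exact_mod_cast Nat.pos_of_ne_zero hN0
  obtain ⟨Lam, hLam⟩ : ∃ Lam : ℝ, Lam = (1 + Real.log N) / δ := ⟨_, rfl⟩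
  have hLam1 : 1 ≤ Lam := by
    have hLg2 : 1 / 2 < Real.log N := Literature.NumberTheory.Sieve.Vinogradov.half_lt_log hN
    rw [hLam, le_div_iff₀ hδ]; linarith
  have hLam0 : 0 < Lam := by linarith
  obtain ⟨t, htdef⟩ : ∃ t : ℝ, t = 2 ^ 11 * Lam ^ 7 := ⟨_, rfl⟩
  obtain ⟨s, hsdef⟩ : ∃ s : ℝ, s = s₀ * Lam ^ (14 * A + 14) := ⟨_, rfl⟩
  have hs1 : 1 ≤ s := by
    rw [hsdef]; exact one_le_mul_of_one_le_of_one_le hs₀1 (one_le_pow₀ hLam1)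
  have hs0 : 0 < s := by linarith
  have ht : 2 ^ 11 * ((1 + Real.log N) / δ) ^ 7 ≤ t := by rw [← hLam, htdef]
  have hst : 2 * t ^ 2 * (C * (8 * t ^ 2) ^ A) ≤ s := by
    rw [hsdef, hs₀, htdef]; exact le_of_eq (s_identity C Lam A)
  -- the final bound dominates both cases
  have hbound : (2 : ℝ) ^ 156 * s ^ 84 = 2 ^ 156 * s₀ ^ 84 * ((1 + Real.log N) / δ) ^ (84 * (14 * A + 14)) := by
    rw [hsdef, mul_pow, ← pow_mul, mul_comm (14 * A + 14) 84, mul_assoc, hLam]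
  rw [← hbound]
  -- `u = ⌊N^{1/3}⌋`
  obtain ⟨u, hudef⟩ : ∃ u : ℕ, u = ⌊(N : ℝ) ^ (1 / 3 : ℝ)⌋₊ := ⟨_, rfl⟩
  have hN13 : 0 ≤ (N : ℝ) ^ (1 / 3 : ℝ) := Real.rpow_nonneg hNr.le _
  have hule : (u : ℝ) ≤ (N : ℝ) ^ (1 / 3 : ℝ) := by rw [hudef]; exact Nat.floor_le hN13
  have hult : (N : ℝ) ^ (1 / 3 : ℝ) < u + 1 := by rw [hudef]; exact Nat.lt_floor_add_one _
  have hcube : ((N : ℝ) ^ (1 / 3 : ℝ)) ^ 3 = N := by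
    rw [← Real.rpow_natCast, ← Real.rpow_mul hNr.le]; norm_num
  have hu3 : u ^ 3 ≤ N := by
    have : (u : ℝ) ^ 3 ≤ N := by
      rw [← hcube]; exact pow_le_pow_left₀ (Nat.cast_nonneg _) hule 3
    exact_mod_cast this
  have hN3 : (N : ℝ) < ((u : ℝ) + 1) ^ 3 := by
    rw [← hcube]; exact pow_lt_pow_left₀ hult hN13 (by norm_num)
  by_cases hularge : 2 ^ 25 * s ^ 14 ≤ (u : ℝ)
  · obtain ⟨q, hq1, hq2, hq3⟩ := exists_denominator_of_large_quadratic_moebius_sum_aux hC1 hW hN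
      hδ hδ1 α β hS ht hst hu3 hularge
    have h17 : (2 : ℝ) ^ 52 * s ^ 17 ≤ 2 ^ 156 * s ^ 84 :=
      mul_le_mul (by norm_num) (pow_le_pow_right₀ hs1 (by norm_num)) (by positivity)
        (by positivity)
    exact ⟨q, hq1, hq2.trans h17, hq3.trans (div_le_div_of_nonneg_right h17 (by positivity))⟩
  · -- small `N`: `q = 1`
    push Not at hularge
    have hNsmall : (N : ℝ) ^ 2 ≤ 2 ^ 156 * s ^ 84 := by
      have h1 : (u : ℝ) + 1 ≤ 2 ^ 26 * s ^ 14 := by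
        have h14 : (1 : ℝ) ≤ s ^ 14 := one_le_pow₀ hs1
        have : (1 : ℝ) ≤ 2 ^ 25 * s ^ 14 := one_le_mul_of_one_le_of_one_le (by norm_num) h14
        have e : (2 : ℝ) ^ 26 * s ^ 14 = 2 ^ 25 * s ^ 14 + 2 ^ 25 * s ^ 14 := by ring
        rw [e]; linarith
      have h2 : (N : ℝ) ≤ (2 ^ 26 * s ^ 14) ^ 3 :=
        hN3.le.trans (pow_le_pow_left₀ (by positivity) h1 3)
      calc (N : ℝ) ^ 2 ≤ ((2 ^ 26 * s ^ 14) ^ 3) ^ 2 := pow_le_pow_left₀ hNr.le h2 2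
        _ = 2 ^ 156 * s ^ 84 := small_identity s
    refine ⟨1, le_rfl, ?_, ?_⟩
    · rw [Nat.cast_one]
      exact one_le_mul_of_one_le_of_one_le (by norm_num) (one_le_pow₀ hs1)
    · rw [Nat.cast_one, one_mul, le_div_iff₀ (by positivity)]
      have hd : distInt α ≤ 1 / 2 := Literature.NumberTheory.Sieve.Vinogradov.distInt_le_half α
      have hd0 : 0 ≤ distInt α := Literature.NumberTheory.Sieve.Vinogradov.distInt_nonneg α
      calc distInt α * (N : ℝ) ^ 2 ≤ 1 / 2 * (2 ^ 156 * s ^ 84) :=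
            mul_le_mul hd hNsmall (by positivity) (by norm_num)
        _ ≤ 1 * (2 ^ 156 * s ^ 84) := mul_le_mul_of_nonneg_right (by norm_num) (by positivity)
        _ = 2 ^ 156 * s ^ 84 := one_mul _

end Literature.NumberTheory.Sieve.QuadraticMoebius
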